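import Mathlib
import Literature.NumberTheory.LFunctions.ZetaArgHSW
import HarnessLib

/-!
# HANDOFF — THE NEAR-NULL BUDGET: the Paley–Wiener count minus the Riemann–von Mangoldt main term at the crossover
# T* = 2πe^{2b} is EXACTLY e^{2b}; the zero count there is within an explicit O(log T*) of it
# (cell rh-explicit, TRACK «HANDOFF», seat theory-2 gen12; FILE XII-δ; calculus + the tree's DISCHARGED Hasanalizade–Shen–Wong bound)

HONEST FRAMING. Nothing in this file bears on the truth of RH. It types the ARITHMETIC of a MODEL sentence of the cell (theory-2
gen11, LADDER note (L9); cc-s2-3/cc-s2-6's count law): «the number of near-null eigen-directions of the full Weil form's section at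
bandwidth b = (log q)/2 + δ is q − 1 (DATA, 13/13 scoreable families, q = 5 … 43); HEURISTIC: functions of exponential type b carry
b/π degrees of freedom per unit τ, the Riemann zeros pin (1/2π) log(τ/2π) of them per unit τ, the two densities cross at T* = 2πe^{2b},
and the excess below the crossover is ∫₀^{T*}(b/π − log(τ/2π)/2π) dτ = e^{2b} = q exactly». What is KERNEL here is only:
§1 the identities — the crossover (`zeroDensity_crossover`), the budget `(b/π)·T* − (T*/2π)·log(T*/2πe) = e^{2b}`
   (`pwCount_sub_mainTerm`), and the density integral `∫₀^{T*}(b/π − (log τ − log 2π)/2π) dτ = e^{2b}` (`integral_density_excess`,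
   Mathlib's `integral_log_from_zero`);
§2 the COUNT version with the true N(T): by the tree's DISCHARGED Hasanalizade–Shen–Wong Corollary 1.2
   (`Literature.NumberTheory.LFunctions.zetaZeroCount_hasanalizade_shen_wong_holds`: |N(T) − (T/2π) log(T/2πe)| ≤ 0.1038 log T +
   0.2573 log log T + 9.3675 for T ≥ e), `|(b/π)·T* − N(T*) − e^{2b}| ≤ 0.1038 log T* + 0.2573 log log T* + 9.3675`
   (`abs_pwCount_sub_zetaZeroCount_sub_exp_le`), and at b = (log q)/2: `|q log q − N(2πq) − q| ≤ …` (`abs_mul_log_sub_zetaZeroCount_sub_le`)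
   — unconditional statements about ζ's zero-counting function, used here only as the heuristic's bookkeeping.
What is NOT here (MODEL/DATA): that the near-null dimension of any section IS this excess (a Landau–Pollak–Slepian-type concentration
statement for the Paley–Wiener space against the zero set — not proved, not claimed), the «− 1» (the refined main term's + 7/8 would
make the heuristic excess q − 7/8 ∓ S(T*): an observation, not a theorem here), anything about the Weil form. No `def`s.
References: B. Riemann 1859 / H. von Mangoldt 1905 (N(T)); E. Hasanalizade, Q. Shen, P.-J. Wong, J. Number Theory 235 (2022), Cor. 1.2
[cite: HasanalizadeShenWong2022, Corollary 1.2] (the tree's discharged fact); H. J. Landau, H. O. Pollak, D. Slepian, Bell System Tech.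
J. 40–41 (1961–62) for the «2WT» degrees-of-freedom heuristic (analogy only).
-/

set_option linter.dupNamespace false  -- the mandated namespace repeats `RiemannHypothesis`

open Real MeasureTheory intervalIntegral
open Literature.NumberTheory.LFunctions

namespace Summit.RiemannHypothesis.RiemannHypothesis.Theorems.HandoffNearNullBudget

/-! ## §1 The exact budget identity of the heuristic -/

/-- The crossover height `T* = 2π e^{2b}` is where the Paley–Wiener density `b/π` (per unit `τ`, functions of exponential type `b`)
meets the zero density `(1/2π) log(τ/2π)`: `(1/2π) log(T*/2π) = b/π`. [folklore] -/
theorem zeroDensity_crossover (b : ℝ) : Real.log (2 * π * Real.exp (2 * b) / (2 * π)) / (2 * π) = b / π := by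
  have h2π : (0 : ℝ) < 2 * π := by positivity
  rw [mul_div_cancel_left₀ _ h2π.ne', Real.log_exp]
  field_simp

/-- **THE BUDGET IDENTITY.** `(b/π)·T* − (T*/2π)·log(T*/(2πe)) = e^{2b}` for `T* = 2π e^{2b}`: the Paley–Wiener count `(b/π)T*`
exceeds the Riemann–von Mangoldt main term at the crossover by EXACTLY `e^{2b}` — for `b = (log q)/2` this is `q`, i.e.
`q log q − [(T/2π) log(T/2πe)]_{T = 2πq} = q`. (MODEL reading in the cell: the near-null dimension `q − 1` of the full Weil form's
section; the refined main term `+ 7/8` would give `q − 7/8`. The identity itself is exact arithmetic.) [folklore] -/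
theorem pwCount_sub_mainTerm (b : ℝ) :
    b / π * (2 * π * Real.exp (2 * b)) - 2 * π * Real.exp (2 * b) / (2 * π) * Real.log (2 * π * Real.exp (2 * b) / (2 * π * Real.exp 1))
      = Real.exp (2 * b) := by
  have hπ : (0 : ℝ) < π := Real.pi_pos
  have h1 : 2 * π * Real.exp (2 * b) / (2 * π * Real.exp 1) = Real.exp (2 * b - 1) := by
    rw [Real.exp_sub, mul_div_mul_left _ _ (by positivity : (2 : ℝ) * π ≠ 0)]
  rw [h1, Real.log_exp]
  field_simp
  ring

/-- **THE DENSITY INTEGRAL.** `∫₀^{T*} (b/π − (1/2π)(log τ − log 2π)) dτ = e^{2b}` for `T* = 2π e^{2b}`: integrating the local excess of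
the Paley–Wiener density over the zero density `(1/2π) log(τ/2π)` (written as `(log τ − log 2π)/2π`, which is the same for `τ > 0`)
up to the crossover gives the same `e^{2b}`; the integrand is positive exactly on `(0, T*)`. [folklore] -/
theorem integral_density_excess (b : ℝ) :
    ∫ τ in (0 : ℝ)..(2 * π * Real.exp (2 * b)), (b / π - (Real.log τ - Real.log (2 * π)) / (2 * π)) = Real.exp (2 * b) := by
  have hπ : (0 : ℝ) < π := Real.pi_pos
  have h2π : (0 : ℝ) < 2 * π := by positivity
  set T := 2 * π * Real.exp (2 * b) with hT
  have hlogT : Real.log T = Real.log (2 * π) + 2 * b := by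
    rw [hT, Real.log_mul h2π.ne' (Real.exp_pos _).ne', Real.log_exp]
  have hI : IntervalIntegrable (fun τ : ℝ ↦ (Real.log τ - Real.log (2 * π)) / (2 * π)) volume 0 T :=
    (intervalIntegral.intervalIntegrable_log'.sub intervalIntegrable_const).div_const _
  rw [intervalIntegral.integral_sub intervalIntegrable_const hI, intervalIntegral.integral_const, intervalIntegral.integral_div,
    intervalIntegral.integral_sub intervalIntegral.intervalIntegrable_log' intervalIntegrable_const, integral_log_from_zero,
    intervalIntegral.integral_const, smul_eq_mul, smul_eq_mul, sub_zero, hlogT]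
  rw [hT]
  field_simp
  ring

/-! ## §2 The zero count at the crossover, by the tree's discharged Hasanalizade–Shen–Wong bound -/

/-- **THE PALEY–WIENER EXCESS OVER THE ZERO COUNT AT THE CROSSOVER.** For `T* = 2π e^{2b} ≥ e`:
`|(b/π)·T* − N(T*) − e^{2b}| ≤ 0.1038·log T* + 0.2573·log log T* + 9.3675`, with `N` the tree's `zetaZeroCount` (zeros `0 < γ ≤ T`,
with multiplicity) — from the budget identity and the DISCHARGED count `zetaZeroCount_hasanalizade_shen_wong_holds`
(Hasanalizade–Shen–Wong 2022, Cor. 1.2). Unconditional; nothing about RH. [cite: HasanalizadeShenWong2022, Corollary 1.2] -/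
theorem abs_pwCount_sub_zetaZeroCount_sub_exp_le (b : ℝ) (hb : Real.exp 1 ≤ 2 * π * Real.exp (2 * b)) :
    |b / π * (2 * π * Real.exp (2 * b)) - (zetaZeroCount (2 * π * Real.exp (2 * b)) : ℝ) - Real.exp (2 * b)|
      ≤ 0.1038 * Real.log (2 * π * Real.exp (2 * b)) + 0.2573 * Real.log (Real.log (2 * π * Real.exp (2 * b))) + 9.3675 := by
  have h := zetaZeroCount_hasanalizade_shen_wong_holds (2 * π * Real.exp (2 * b)) hb
  have hid := pwCount_sub_mainTerm b
  have key : b / π * (2 * π * Real.exp (2 * b)) - (zetaZeroCount (2 * π * Real.exp (2 * b)) : ℝ) - Real.exp (2 * b)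
      = -((zetaZeroCount (2 * π * Real.exp (2 * b)) : ℝ)
        - 2 * π * Real.exp (2 * b) / (2 * π) * Real.log (2 * π * Real.exp (2 * b) / (2 * π * Real.exp 1))) := by
    linarith
  rw [key, abs_neg]
  exact h

/-- The same at a PRIME-LIKE bandwidth `b = (log q)/2` (`q > 0` real): `T* = 2πq`, `e^{2b} = q`, and
`|q·log q − N(2πq) − q| ≤ 0.1038·log(2πq) + 0.2573·log log(2πq) + 9.3675` whenever `2πq ≥ e` — «N(2πq) = q log q − q + O(log q)»;
the excess of `q log q` over the zero count below `2πq` is `q` up to the error (the cell's measured near-null count at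
`b = (log q)/2 + δ` is `q − 1`; DATA, not this theorem). [cite: HasanalizadeShenWong2022, Corollary 1.2] -/
theorem abs_mul_log_sub_zetaZeroCount_sub_le {q : ℝ} (hq : 0 < q) (hqe : Real.exp 1 ≤ 2 * π * q) :
    |q * Real.log q - (zetaZeroCount (2 * π * q) : ℝ) - q|
      ≤ 0.1038 * Real.log (2 * π * q) + 0.2573 * Real.log (Real.log (2 * π * q)) + 9.3675 := by
  have hπ : (0 : ℝ) < π := Real.pi_pos
  have hb : Real.exp (2 * (Real.log q / 2)) = q := by
    rw [mul_div_cancel₀ _ (two_ne_zero), Real.exp_log hq]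
  have h := abs_pwCount_sub_zetaZeroCount_sub_exp_le (Real.log q / 2) (by rw [hb]; exact hqe)
  have e1 : Real.log q / 2 / π * (2 * π * q) = q * Real.log q := by
    field_simp
  rw [hb, e1] at h
  exact h

end Summit.RiemannHypothesis.RiemannHypothesis.Theorems.HandoffNearNullBudget
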